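import Mathlib.Analysis.SpecialFunctions.Complex.Log
import Mathlib.RingTheory.Algebraic.Basic
import Literature.NumberTheory.Transcendental.GelfondSchneiderProofs

/-!
# `VolumeFormOffPlane` (stmt-KontsevichZagierPeriods-14935) — line `Sketch`,
stub `stub_rankTwoLogRatio`

Target: `Summits/KontsevichZagierPeriods/KontsevichZagierPeriods/Theorems/SymplecticScissorsVolumeFormOffPlaneRankTwoLogRatio.lean`.
The theorem `stub_rankTwoLogRatio` below keeps EXACTLY the registered signature.

Rank-two homogeneous log-independence: for multiplicatively independent positive real algebraic
numbers `α, β`, no non-zero homogeneous binary form over `ℚ` vanishes at `(log α, log β)`.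

* `log β ≠ 0` (else `β = 1 = α ^ 0 · β ^ 1`, contradicting independence with `(p, q) = (0, 1)`);
* `t := log α / log β` is irrational: `t = p / q` gives `α ^ q · β ^ (-p) = 1`, so `q = 0`;
* `t` is transcendental (Gelfond–Schneider in Schneider form, the tree's
  `gelfond_schneider_holds`, applied over `ℂ` to `a := β`, `l := log β`, `b := t`: if `t` were
  algebraic then `e^{t log β} = α` would be transcendental);
* dividing the vanishing form by `(log β) ^ d` gives `Σ c_k t^k = 0`, a rational polynomial
  relation for the transcendental `t`, so all `c_k` vanish.

## References

* A. O. Gelfond (1934), Th. Schneider (1934); A. Baker, *Transcendental Number Theory* (1975),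
  Theorem 2.1 / 2.4 — in the tree as `Literature.NumberTheory.Transcendental.gelfond_schneider_holds`.
-/

noncomputable section

open Literature.NumberTheory.Transcendental

namespace Summit.KontsevichZagierPeriods.SymplecticScissors.LogPolytope

/-- For multiplicatively independent positive reals `α, β` (no non-trivial relation
`α ^ p · β ^ q = 1`), `log β ≠ 0`: otherwise `β = 1` and `(p, q) = (0, 1)` is a relation.
[folklore] -/
theorem rtlr_log_ne_zero {α β : ℝ} (hβ : 0 < β)
    (hind : ∀ p q : ℤ, α ^ p * β ^ q = 1 → p = 0 ∧ q = 0) : Real.log β ≠ 0 := by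
  intro h
  have hβ1 : β = 1 := by
    rcases Real.log_eq_zero.mp h with h0 | h1 | hm1
    · exact absurd h0 hβ.ne'
    · exact h1
    · linarith
  have h01 := hind 0 1 (by simp [hβ1])
  exact one_ne_zero h01.2

/-- For multiplicatively independent positive reals `α, β`, the ratio `log α / log β` is not a
rational number: `log α / log β = p / q` exponentiates to `α ^ q · β ^ (-p) = 1`. [folklore] -/
theorem rtlr_log_div_log_ne_ratCast {α β : ℝ} (hα : 0 < α) (hβ : 0 < β)
    (hind : ∀ p q : ℤ, α ^ p * β ^ q = 1 → p = 0 ∧ q = 0) (r : ℚ) :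
    Real.log α / Real.log β ≠ (r : ℝ) := by
  have hY : Real.log β ≠ 0 := rtlr_log_ne_zero hβ hind
  intro hr
  rw [Rat.cast_def, div_eq_div_iff hY (by exact_mod_cast r.den_ne_zero)] at hr
  -- `hr : log α * r.den = r.num * log β`; exponentiate the relation `den • log α - num • log β = 0`
  have hpos : 0 < α ^ (r.den : ℤ) * β ^ (-r.num) := by positivity
  have hlog : Real.log (α ^ (r.den : ℤ) * β ^ (-r.num)) = 0 := by
    rw [Real.log_mul (zpow_ne_zero _ hα.ne') (zpow_ne_zero _ hβ.ne'), Real.log_zpow,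
      Real.log_zpow]
    push_cast
    linarith
  have hone : α ^ (r.den : ℤ) * β ^ (-r.num) = 1 := by
    rw [← Real.exp_log hpos, hlog, Real.exp_zero]
  have hden : (r.den : ℤ) = 0 := (hind _ _ hone).1
  exact r.den_ne_zero (by exact_mod_cast hden)

/-- **Schneider's form of Gelfond–Schneider, real rank two.** For multiplicatively independent
positive real algebraic `α, β`, the ratio `log α / log β` is transcendental: it is irrational
(`rtlr_log_div_log_ne_ratCast`), and if it were algebraic irrational then
`β ^ (log α / log β) = α` would be transcendental by the Gelfond–Schneider theorem
(`gelfond_schneider_holds`). [cite: Gelfond1934] -/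
theorem rtlr_transcendental_log_div_log {α β : ℝ} (hα : 0 < α) (hβ : 0 < β)
    (hαa : IsAlgebraic ℚ α) (hβa : IsAlgebraic ℚ β)
    (hind : ∀ p q : ℤ, α ^ p * β ^ q = 1 → p = 0 ∧ q = 0) :
    Transcendental ℚ (Real.log α / Real.log β) := by
  have hY : Real.log β ≠ 0 := rtlr_log_ne_zero hβ hind
  intro htalg
  -- real algebraic numbers are complex algebraic numbers
  have ofC : ∀ {x : ℝ}, IsAlgebraic ℚ x → IsAlgebraic ℚ (x : ℂ) := fun hx =>
    (isAlgebraic_algebraMap_iff (A := ℂ) Complex.ofReal_injective).mpr hx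
  -- the ratio is not rational, read in `ℂ`
  have htq : ((Real.log α / Real.log β : ℝ) : ℂ) ∉ Set.range ((↑) : ℚ → ℂ) := by
    rintro ⟨r, hr⟩
    refine rtlr_log_div_log_ne_ratCast hα hβ hind r ?_
    have hr' : ((r : ℝ) : ℂ) = ((Real.log α / Real.log β : ℝ) : ℂ) := by
      rw [Complex.ofReal_ratCast]
      exact hr
    exact (Complex.ofReal_injective hr').symm
  -- `log β` is a non-zero logarithm of the algebraic number `β`
  have hl : Complex.exp ((Real.log β : ℝ) : ℂ) = (β : ℂ) := by
    rw [← Complex.ofReal_exp, Real.exp_log hβ]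
  have hl0 : ((Real.log β : ℝ) : ℂ) ≠ 0 := by exact_mod_cast hY
  have htr := gelfond_schneider_holds (ofC hβa) (ofC htalg) htq hl hl0
  -- but `exp ((log α / log β) * log β) = α` is algebraic
  have hexp : Complex.exp (((Real.log α / Real.log β : ℝ) : ℂ) * ((Real.log β : ℝ) : ℂ)) =
      (α : ℂ) := by
    rw [← Complex.ofReal_mul, ← Complex.ofReal_exp, div_mul_cancel₀ _ hY, Real.exp_log hα]
  rw [hexp] at htr
  exact htr (ofC hαa)

/-- **Stub (rank-two homogeneous log-independence; Gelfond–Schneider in Schneider form).** For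
multiplicatively independent positive real algebraic `α, β`, the ratio `log α / log β` is
irrational, hence transcendental (Gelfond 1934 / Schneider 1934: `β^{t} = α` algebraic forces
`t ∈ ℚ` or `t ∉ ℚ̄`; the tree's `gelfond_schneider_holds`), so no non-zero homogeneous form over
`ℚ` vanishes at `(log α, log β)` (dehomogenise by `(log β)^d`). [cite: Gelfond1934] -/
theorem stub_rankTwoLogRatio : ∀ (α β : ℝ), 0 < α → 0 < β → IsAlgebraic ℚ α → IsAlgebraic ℚ β →
    (∀ p q : ℤ, α ^ p * β ^ q = 1 → p = 0 ∧ q = 0) →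
    ∀ (d : ℕ) (c : Fin (d + 1) → ℚ),
    ∑ k : Fin (d + 1), (c k : ℝ) * Real.log α ^ (k : ℕ) * Real.log β ^ (d - (k : ℕ)) = 0 →
    ∀ k, c k = 0 := by
  intro α β hα hβ hαa hβa hind d c hsum
  classical
  have hY : Real.log β ≠ 0 := rtlr_log_ne_zero hβ hind
  have htr := rtlr_transcendental_log_div_log hα hβ hαa hβa hind
  -- dehomogenise: `X ^ k * Y ^ (d - k) = (X / Y) ^ k * Y ^ d`
  have hXk : ∀ k : ℕ, k ≤ d → Real.log α ^ k * Real.log β ^ (d - k) =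
      (Real.log α / Real.log β) ^ k * Real.log β ^ d := by
    intro k hk
    rw [div_pow, div_mul_eq_mul_div, eq_div_iff (pow_ne_zero _ hY), mul_assoc, ← pow_add,
      Nat.sub_add_cancel hk]
  have hfac : ∑ k : Fin (d + 1), (c k : ℝ) * Real.log α ^ (k : ℕ) * Real.log β ^ (d - (k : ℕ)) =
      (∑ k : Fin (d + 1), (c k : ℝ) * (Real.log α / Real.log β) ^ (k : ℕ)) * Real.log β ^ d := by
    rw [Finset.sum_mul]
    refine Finset.sum_congr rfl fun k _ => ?_
    rw [mul_assoc, hXk k k.is_le, mul_assoc]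
  have hsum' : ∑ k : Fin (d + 1), (c k : ℝ) * (Real.log α / Real.log β) ^ (k : ℕ) = 0 := by
    rw [hfac] at hsum
    exact (mul_eq_zero.mp hsum).resolve_right (pow_ne_zero _ hY)
  -- the rational polynomial `P = Σ c_k X^k` vanishes at the transcendental ratio, so `P = 0`
  have hP : (∑ k : Fin (d + 1), Polynomial.monomial (k : ℕ) (c k) : Polynomial ℚ) = 0 := by
    refine transcendental_iff.mp htr _ ?_
    simp only [map_sum, Polynomial.aeval_monomial, eq_ratCast]
    exact hsum'
  -- read off the coefficient of `X ^ k`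
  intro k
  have hcoeff : (∑ j : Fin (d + 1), Polynomial.monomial (j : ℕ) (c j) : Polynomial ℚ).coeff
      (k : ℕ) = c k := by
    rw [Polynomial.finsetSum_coeff, Finset.sum_eq_single k]
    · simp
    · intro j _ hj
      simp [Polynomial.coeff_monomial, Fin.val_ne_of_ne hj]
    · intro h
      exact absurd (Finset.mem_univ k) h
  rw [← hcoeff, hP, Polynomial.coeff_zero]

end Summit.KontsevichZagierPeriods.SymplecticScissors.LogPolytope
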